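import Summits.HodgeConjecture.HodgeConjecture.Theorems.Ring2AbelianAllAndreSpreadLift
import Literature.AlgebraicGeometry.HodgeTheory.SpreadAlgebraicClassesOverCurve
import HarnessLib

/-!
# Ring 2 · sub-cell AbelianAll (ALL ABELIAN VARIETIES), André axis, part XIX-d — part XIX-a's rows BY NAME of the
# Literature named fact `HodgeTheory.spread_algebraicClasses_over_smoothCurve` (the hypothesis shape `SpreadCurve[]`
# instantiated; for the census: the lift-side edges now reference ONE fact constant, D-0026 debt +1, never fact-free)

HONEST FRAMING (page 1, verbatim): **research route, not a corollary; conditional on HC_CM plus one named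
minimal statement.** Cell line: research route conditional on HC_CM; not a corollary; Q11.4-sentence-2 already
refuted in dim ≥ 3. Nothing in this file proves a case of the Hodge conjecture for an abelian variety; `HC_CM`, `HC_AV`,
`h₂₁` and the spreading fact are BINDERS; the reduction item `CMToAbelian` (stmt-HodgeConjecture-16267) is NOT closed.

Each theorem is part XIX-a's theorem of the same name without the prime, with `(hSp : SpreadCurve[])` replaced by the
named fact `(hSp : spread_algebraicClasses_over_smoothCurve)` (whose body `SpreadCurve[]` is, verbatim; the proofs are
`exact`). Citation wording for the fact (REFEREE-AB F-ab-87): "classical; see the PROOF of [Voisin II, Thm. 10.19]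
(relative Hilbert schemes, dominating component, multisection, push-forward) and [Charles–Schnell, proof of
Prop. 11.3.11]" — never "[Voisin II, Thm. 10.19]" itself (a Chow-group statement of a different shape). EDGE LABELS:
K[spread_algebraicClasses_over_smoothCurve]. No `def`, no `sorry`; axioms standard.

References: VoisinHodgeII2003 (§3.3.1; §10.2.1, proof of Thm. 10.19); CharlesSchnell2014Notes (Prop. 11.3.11 proof,
Cor. 11.3.6); Andre1996Motifs (Lemme 6.3.1 p. 31, Remarque 2 p. 33); Milne2020HodgeClassesAV (Prop. 1 p. 7);
MoonenZarhin1999LowDim (Thms. 0.1–0.2); Markman2025SecantWeil (Cor. 1.6.1).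
-/

noncomputable section

set_option linter.dupNamespace false

namespace Summit.HodgeConjecture.HodgeConjecture.Ring2.AbelianAll

open CategoryTheory AlgebraicGeometry
open Literature.AlgebraicGeometry Literature.AlgebraicGeometry.Motives
open Literature.AlgebraicGeometry.HodgeTheory
open Literature.AlgebraicGeometry.Andre1996 (andre1996_cmAnchoredPencil)
open Summit.HodgeConjecture.HodgeConjecture
open Summit.HodgeConjecture.HodgeConjecture.Theses
open Summit.HodgeConjecture.HodgeConjecture.Ring2.Deform (CompactAbelianPencilVHC)

variable {𝒳 S : SchemeOver ℂ}

/-- **(2) ⟺ (L∀)**, granted the spreading fact by name. [cite: VoisinHodgeII2003, §3.3.1 and §10.2.1, proof of Thm. 10.19]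
[cite: Milne2020HodgeClassesAV, Prop. 1 (p. 7)] -/
theorem algebraicFixedPart_iff_compactAbelianPencilVHC' (hSp : spread_algebraicClasses_over_smoothCurve) :
    AlgebraicFixedPart ↔ CompactAbelianPencilVHC :=
  algebraicFixedPart_iff_compactAbelianPencilVHC hSp

/-- **(4) ⟺ (L)**, granted the spreading fact by name. [cite: VoisinHodgeII2003, §3.3.1 and §10.2.1, proof of Thm. 10.19]
[cite: Andre1996Motifs, §6.3 a) (p. 33)] -/
theorem cmFibreAlgebraicLift_iff_cmAnchoredTransport' (hSp : spread_algebraicClasses_over_smoothCurve) :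
    CMFibreAlgebraicLift ↔ CMAnchoredTransport :=
  cmFibreAlgebraicLift_iff_cmAnchoredTransport hSp

/-- **ON-PATH: `HC_AV ⟹ (L∀)`**, granted the spreading fact by name. [cite: CharlesSchnell2014Notes, Cor. 11.3.6 (p. 494)]
[cite: VoisinHodgeII2003, §3.3.1 and §10.2.1, proof of Thm. 10.19] -/
theorem algebraicFixedPart_of_HC_AV' (hSp : spread_algebraicClasses_over_smoothCurve)
    (h : PadicSemiregularLift.HodgeAbelianVarieties) : AlgebraicFixedPart :=
  algebraicFixedPart_of_HC_AV hSp h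

/-- **EXACTNESS of (L): `HC_AV ⟺ HC_CM ∧ CMFibreAlgebraicLift`** (mod Lemme 6.3.1 and the spreading fact, by name).
`HC_CM`, `h₂₁` BINDERS. research route, not a corollary; conditional on HC_CM plus one named minimal statement.
[cite: Andre1996Motifs, Lemme 6.3.1 (p. 31) and Remarque 2 (p. 33)] [cite: VoisinHodgeII2003, §10.2.1, proof of Thm. 10.19] -/
theorem HC_AV_iff_HC_CM_and_cmFibreAlgebraicLift' (h₂₁ : andre1996_cmAnchoredPencil)
    (hSp : spread_algebraicClasses_over_smoothCurve) :
    PadicSemiregularLift.HodgeAbelianVarieties ↔ (RankFourFaces.CMAbelianHodge ∧ CMFibreAlgebraicLift) :=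
  HC_AV_iff_HC_CM_and_cmFibreAlgebraicLift h₂₁ hSp

/-- **EXACTNESS of (L∀): `HC_AV ⟺ HC_CM ∧ AlgebraicFixedPart`** (mod Lemme 6.3.1 and the spreading fact, by name).
[cite: Andre1996Motifs, Lemme 6.3.1 (p. 31) and Remarque 2 (p. 33)] [cite: Milne2020HodgeClassesAV, Prop. 1 (p. 7)] -/
theorem HC_AV_iff_HC_CM_and_algebraicFixedPart' (h₂₁ : andre1996_cmAnchoredPencil)
    (hSp : spread_algebraicClasses_over_smoothCurve) :
    PadicSemiregularLift.HodgeAbelianVarieties ↔ (RankFourFaces.CMAbelianHodge ∧ AlgebraicFixedPart) :=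
  HC_AV_iff_HC_CM_and_algebraicFixedPart h₂₁ hSp

/-- **The reduction item in lift form: `CMToAbelian ⟺ (HC_CM → CMFibreAlgebraicLift)`** (mod Lemme 6.3.1 and the
spreading fact, by name). Nothing closes the item. [cite: Andre1996Motifs, Remarque 2 (p. 33)] -/
theorem cmToAbelian_iff_HC_CM_imp_cmFibreAlgebraicLift' (h₂₁ : andre1996_cmAnchoredPencil)
    (hSp : spread_algebraicClasses_over_smoothCurve) :
    RankFourFaces.CMToAbelian ↔ (RankFourFaces.CMAbelianHodge → CMFibreAlgebraicLift) :=
  cmToAbelian_iff_HC_CM_imp_cmFibreAlgebraicLift h₂₁ hSp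

/-- **Under `HC_CM` all five André-axis nodes coincide** (mod Lemme 6.3.1 and the spreading fact, by name).
[cite: Andre1996Motifs, Remarque 2 (p. 33)] -/
theorem liftCandidates_iff_of_HC_CM' (h₂₁ : andre1996_cmAnchoredPencil) (hCM : RankFourFaces.CMAbelianHodge)
    (hSp : spread_algebraicClasses_over_smoothCurve) :
    (AlgebraicFixedPart ↔ CMAnchoredTransport) ∧ (CMFibreAlgebraicLift ↔ CMAnchoredTransport) ∧
      (CMPointedPencilVHC ↔ CMAnchoredTransport) ∧ (CompactAbelianPencilVHC ↔ CMAnchoredTransport) :=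
  liftCandidates_iff_of_HC_CM h₂₁ hCM hSp

/-- **Relative dimension 4: the algebraic fixed part for compact pencils of abelian FOURFOLDS** modulo the spreading
fact, Moonen–Zarhin 1999 Thm. 0.1 and Markman 2025, all by name. [cite: MoonenZarhin1999LowDim, Thm. 0.1 with (1.4), (1.9)]
[cite: Markman2025SecantWeil, Cor. 1.6.1] [cite: VoisinHodgeII2003, §10.2.1, proof of Thm. 10.19] -/
theorem algebraicFixedPart_body_of_relDim_four' (hSp : spread_algebraicClasses_over_smoothCurve)
    (h01 : MoonenZarhin1999_codimTwoHodgeClasses_abelianFourfold)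
    (hM : Markman2025_weilClasses_algebraic_abelianFourfold) {f : 𝒳 ⟶ S}
    (hf : IsCompactAbelianPencil f 4) (p : ℕ) (W : complexBetti 𝒳 (2 * p))
    (hW : ∀ s : ComplexPoints S, IsRationalClass (complexBetti.map (fiberι f s) (2 * p) W) ∧
      IsOfHodgeType 4 (fiberOver f s) (2 * p) p p (complexBetti.map (fiberι f s) (2 * p) W))
    (s₀ : ComplexPoints S) :
    ∃ η ∈ algebraicClasses 𝒳 p,
      complexBetti.map (fiberι f s₀) (2 * p) η = complexBetti.map (fiberι f s₀) (2 * p) W :=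
  algebraicFixedPart_body_of_relDim_four hSp h01 hM hf p W hW s₀

/-- **Relative dimension 5** likewise (Moonen–Zarhin 1999 Thms. 0.1–0.2, Markman 2025, spreading — by name).
[cite: MoonenZarhin1999LowDim, Thm. 0.2 with (2.8), §5 (5.11)] [cite: Markman2025SecantWeil, Cor. 1.6.1]
[cite: VoisinHodgeII2003, §10.2.1, proof of Thm. 10.19] -/
theorem algebraicFixedPart_body_of_relDim_five' (hSp : spread_algebraicClasses_over_smoothCurve)
    (h01 : MoonenZarhin1999_codimTwoHodgeClasses_abelianFourfold)
    (h02 : MoonenZarhin1999_codimTwoHodgeClasses_abelianFivefold)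
    (hM : Markman2025_weilClasses_algebraic_abelianFourfold) {f : 𝒳 ⟶ S}
    (hf : IsCompactAbelianPencil f 5) (p : ℕ) (W : complexBetti 𝒳 (2 * p))
    (hW : ∀ s : ComplexPoints S, IsRationalClass (complexBetti.map (fiberι f s) (2 * p) W) ∧
      IsOfHodgeType 5 (fiberOver f s) (2 * p) p p (complexBetti.map (fiberι f s) (2 * p) W))
    (s₀ : ComplexPoints S) :
    ∃ η ∈ algebraicClasses 𝒳 p,
      complexBetti.map (fiberι f s₀) (2 * p) η = complexBetti.map (fiberι f s₀) (2 * p) W :=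
  algebraicFixedPart_body_of_relDim_five hSp h01 h02 hM hf p W hW s₀

end Summit.HodgeConjecture.HodgeConjecture.Ring2.AbelianAll

end
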